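import Mathlib
import Literature.Barriers.ValiantsHypothesis.AlgebraicNaturalProofs
import Summits.ValiantsHypothesis.ValiantsHypothesis.Theorems.BarrierLeverPartitionMinorsHitByVPProductStatesGeneral

/-!
# Route BarrierLever — item `PartitionMinorsHitByVP` (stmt-ValiantsHypothesis-19717):
# sums of product states with a COMMON pairing miss every CROSS layout (a no-go for one witness door)

Helper file (`--supports stmt-ValiantsHypothesis-19717`; cell valiant-natproofs, rung V4, 𝒟-side,
prover seat val-np-p3 gen 2). Definition-free. Closes NO item; it bounds a witness FAMILY, not the item.

A product state with site tables `m a : Bool → Bool → ℂ` and pairing `π` (`…ProductStatesC`) has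
layout coefficient `∏_a m a [a ∈ U] [π a ∈ W]` (`coeff_prodStateC`). On a CROSS LAYOUT — all rows
`u i ⊆ D`, all columns disjoint from `π(D)` — every such state is RANK ONE on the layout (the sites in `D`
only see the row, the others only see the column), so a linear combination of `m` product states sharing
the pairing `π` has layout rank `≤ m` and its layout determinant VANISHES as soon as `m < r`.
Example (the "twin layouts" of the census HOME/val-np-p3/VALNP3-G2-MEMO.md §7): `D` = half of the
coordinates, rows = all subsets of `D`, columns = all subsets of `Dᶜ`, `π = 1`: `r = 2^{h/2}` identity-
paired product states are necessary (and, by the census, sufficient), while ONE product state with a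
pairing exchanging `D` and `Dᶜ` hits it (`…Automorphic`, prover gen 6). So "number of product states" is
the wrong size measure unless pairings vary.

* **`det_sum_prodStateC_eq_zero_of_cross`** — the no-go.

WHAT THIS IS NOT: no statement about other witness families (TNS kernels, re-paired states, MPS in
other orders all hit these layouts numerically); nothing on crux 14610 / VP vs VNP.
-/

set_option linter.dupNamespace false

namespace Summit.ValiantsHypothesis.ValiantsHypothesis.Theorems.BarrierLever.ProductStatesCross

open Finset MvPolynomial
open Summit.ValiantsHypothesis.ValiantsHypothesis.Theorems.BarrierLever.ProductStatesC (coeff_prodStateC)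

variable {h r m : ℕ}

/-- **Cross layouts defeat commonly-paired product states.** If every row lies inside `D`, every
column avoids `π(D)`, and `m < r`, then any linear combination of `m` product states with the common
pairing `π` (arbitrary complex site tables) has VANISHING layout determinant. -/
theorem det_sum_prodStateC_eq_zero_of_cross (π : Equiv.Perm (Fin h)) (D : Finset (Fin h))
    (u w : Fin r → Finset (Fin h)) (hu : ∀ i, u i ⊆ D) (hw : ∀ j, ∀ a ∈ D, π a ∉ w j)
    (hmr : m < r) (tab : Fin m → Fin h → Bool → Bool → ℂ) (c : Fin m → ℂ) :
    (Matrix.of fun i j : Fin r => MvPolynomial.coeff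
      (∑ a ∈ u i, Finsupp.single (Fin.castAdd h a) 1 + ∑ c ∈ w j, Finsupp.single (Fin.natAdd h c) 1)
      (∑ k : Fin m, MvPolynomial.C (c k) *
        ∏ a, ∑ p : Bool × Bool, MvPolynomial.C (tab k a p.1 p.2) * MvPolynomial.X (Fin.castAdd h a) ^ p.1.toNat *
          MvPolynomial.X (Fin.natAdd h (π a)) ^ p.2.toNat : MvPolynomial (Fin (h + h)) ℂ)).det = 0 := by
  classical
  -- row factors (sites in D) and column factors (sites outside D)
  set α : Fin m → Fin r → ℂ := fun k i => c k * ∏ a ∈ D, tab k a (decide (a ∈ u i)) false with hα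
  set β : Fin m → Fin r → ℂ := fun k j => ∏ a ∈ Dᶜ, tab k a false (decide (π a ∈ w j)) with hβ
  set A : Matrix (Fin r) (Fin m) ℂ := Matrix.of fun i k => α k i with hA
  set B : Matrix (Fin m) (Fin r) ℂ := Matrix.of fun k j => β k j with hB
  have hentry : ∀ i j : Fin r, MvPolynomial.coeff
      (∑ a ∈ u i, Finsupp.single (Fin.castAdd h a) 1 + ∑ c ∈ w j, Finsupp.single (Fin.natAdd h c) 1)
      (∑ k : Fin m, MvPolynomial.C (c k) *
        ∏ a, ∑ p : Bool × Bool, MvPolynomial.C (tab k a p.1 p.2) * MvPolynomial.X (Fin.castAdd h a) ^ p.1.toNat *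
          MvPolynomial.X (Fin.natAdd h (π a)) ^ p.2.toNat : MvPolynomial (Fin (h + h)) ℂ) = (A * B) i j := by
    intro i j
    rw [coeff_sum, Matrix.mul_apply]
    refine Finset.sum_congr rfl fun k _ => ?_
    rw [coeff_C_mul, coeff_prodStateC, hA, hB, Matrix.of_apply, Matrix.of_apply, hα, hβ]
    simp only
    rw [mul_assoc, ← Finset.prod_mul_prod_compl D (fun a => tab k a (decide (a ∈ u i)) (decide (π a ∈ w j)))]
    congr 2
    · refine Finset.prod_congr rfl fun a ha => ?_
      rw [decide_eq_false (hw j a ha)]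
    · refine Finset.prod_congr rfl fun a ha => ?_
      have ha' : a ∉ u i := fun hh => (Finset.mem_compl.mp ha) (hu i hh)
      rw [decide_eq_false ha']
  have hM : (Matrix.of fun i j : Fin r => MvPolynomial.coeff
      (∑ a ∈ u i, Finsupp.single (Fin.castAdd h a) 1 + ∑ c ∈ w j, Finsupp.single (Fin.natAdd h c) 1)
      (∑ k : Fin m, MvPolynomial.C (c k) *
        ∏ a, ∑ p : Bool × Bool, MvPolynomial.C (tab k a p.1 p.2) * MvPolynomial.X (Fin.castAdd h a) ^ p.1.toNat *
          MvPolynomial.X (Fin.natAdd h (π a)) ^ p.2.toNat : MvPolynomial (Fin (h + h)) ℂ)) = A * B := by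
    ext i j
    rw [Matrix.of_apply, hentry]
  rw [hM]
  -- rank (A * B) ≤ m < r, so A * B is not invertible
  by_contra hdet
  have hunit : IsUnit (A * B) :=
    (Matrix.isUnit_iff_isUnit_det _).mpr (isUnit_iff_ne_zero.mpr hdet)
  have hrank : (A * B).rank = Fintype.card (Fin r) := Matrix.rank_of_isUnit _ hunit
  have hle : (A * B).rank ≤ Fintype.card (Fin m) :=
    (Matrix.rank_mul_le_left A B).trans (Matrix.rank_le_card_width A)
  rw [hrank, Fintype.card_fin, Fintype.card_fin] at hle
  omega

end Summit.ValiantsHypothesis.ValiantsHypothesis.Theorems.BarrierLever.ProductStatesCross
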